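import Summits.QuantumFields.YangMills.Theorems.AllWindowsColdBoxBoxHighLineBoxToChartReductionCore

/-!
# T-S5.13A «box → FP-chart small-field reduction» (Steps A+B+C of ASSEMBLY-S5): the two-plaquette covariance of the cold box versus the
# covariance under the Faddeev–Popov chart weight on the small-field set (LEAD sfw-p2 g77's consumption list, 2026-08-29T20:23:50Z; LINE-19 S5 ⟨stmt-QuantumFields-24004⟩/⟨24335⟩)

Width seat `ym-line-sfw-p2-w2` (g31).  With `c₀ = plaqCostAt (boxCentre H) 1 2`, `c_T = plaqCostAt (boxCentre H + T e₀) 1 2`, `w_J = fpChartWeight β H r`,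
`D = smallField H s`, `⟨G⟩_D := ∫_D G(U(a)) w_J / ∫_D w_J`:

  `|boxPlaqCov β H T − (⟨c₀c_T⟩_D − ⟨c₀⟩_D⟨c_T⟩_D)| ≤ 200·(δ + P_box(¬SP) + τ)`

under (i)/(ii) of ✓`fpRepresentation` VERBATIM, the ✓LEMMA-6s parameters (`0 ≤ s ≤ 1/100`, `17s² ≤ spl²`) and the conclusion of ✓T-S5.6
`SmallFieldInsideFP` as the hypothesis `hτ` — by the per-observable reduction ✓`BoxToChart.abs_boxState_sub_smallField_ratio_le` of the core file
applied to `c₀/4`, `c_T/4`, `c₀c_T/16` (✓`plaqCostAt_nonneg`, ✓`abs_plaqCostAt_le`, ✓`plaqCostAt_gaugeTransformZd`, ✓`measurable_plaqCostAt`) and the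
covariance algebra ✓`BoxToChart.cov_arith` (`48·(4δ + 4p + 2τ) ≤ 200(δ + p + τ)`).

Everything proved, tree + Mathlib; no definitions; standard axioms.
HONEST LABEL: measure plumbing for the T-S5.13 assembly of the XL stub S5 (`stub_landauSecondOrder`) of a critic-PASSed DRAFT line; the rarity `p`, the
small-field mass `τ` and (i)/(ii) remain INPUTS; S5, U5, ⟨24004⟩ ⟨24335⟩ ⟨24336⟩ remain OPEN; no stub is closed by name, no crux, rung or summit is proved;
**the Yang–Mills mass gap is NOT proved by this file.**
-/

set_option autoImplicit false

noncomputable section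

open MeasureTheory
open Literature.Probability.LatticeModels (Site)
open Literature.MathematicalPhysics.QuantumFieldTheory.AxialGauge (boxEdges)
open Literature.MathematicalPhysics.QuantumLattice (LGConfig gaugeTransformZd fundamentalRep)
open Summit.QuantumFields.YangMills.Theorems.WeakCouplingRates (boxState boxCentre plaqCostAt boxPlaqCov measurable_plaqCostAt abs_plaqCostAt_le
  plaqCostAt_nonneg plaqCostAt_gaugeTransformZd)

namespace Summit.QuantumFields.YangMills.Theorems.AllWindowsColdBoxBoxHighLine

open FPRep

namespace BoxToChart

variable {H : ℕ}

/-! ## The two-plaquette covariance -/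

/-- ★★ **T-S5.13A «box → FP-chart small-field reduction».**  With `c₀ = plaqCostAt (boxCentre H) 1 2`, `c_T = plaqCostAt (boxCentre H + T e₀) 1 2`,
`w = fpChartWeight β H r`, `D = smallField H s`:
`|boxPlaqCov β H T − (∫_D c₀c_T w/∫_D w − (∫_D c₀ w/∫_D w)(∫_D c_T w/∫_D w))| ≤ 200·(δ + P_box(¬SP) + τ)`. -/
theorem boxPlaqCov_sub_chartCov_le (H : ℕ) (hH : 1 ≤ H) {β r r₀ spl s δ τ : ℝ} (T : ℕ) (hβ : 0 < β) (hδ0 : 0 ≤ δ) (hδ : δ ≤ 1 / 2)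
    (hrep : ∀ U : LGConfig 4 SU2, ColdWall H U → SmallPlaquettes H spl U →
        ∃ g : Site 4 → SU2, IsInteriorGauge H g ∧ InLandauGauge H (gaugeTransformZd g U) ∧
          ∀ e ∈ boxEdges 4 (2 * H + 1), linkDefect (gaugeTransformZd g U) e ≤ r₀ ^ 2)
    (hN : ∀ V : LGConfig 4 SU2, InLandauGauge H V → (∀ e ∈ boxEdges 4 (2 * H + 1), linkDefect V e ≤ r₀ ^ 2) →
        |orbitAverage H (jacWeight β H r) V / laplaceZ0 β H - 1| ≤ δ)
    (hs0 : 0 ≤ s) (hs1 : s ≤ 1 / 100) (hspl : 17 * s ^ 2 ≤ spl ^ 2) (hτ0 : 0 ≤ τ)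
    (hτ : ∫ a in chartDomain H \ smallField H s, fpChartWeight β H r a ≤ τ * ∫ a in smallField H (s / 2), fpChartWeight β H r a) :
    |boxPlaqCov (fundamentalRep (Fin 2)) β H T -
        ((∫ a in smallField H s, chartPlaqCost H (boxCentre H) 1 2 a * chartPlaqCost H (boxCentre H + Pi.single 0 (T : ℤ)) 1 2 a *
              fpChartWeight β H r a) / (∫ a in smallField H s, fpChartWeight β H r a) -
          (∫ a in smallField H s, chartPlaqCost H (boxCentre H) 1 2 a * fpChartWeight β H r a) /
              (∫ a in smallField H s, fpChartWeight β H r a) *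
            ((∫ a in smallField H s, chartPlaqCost H (boxCentre H + Pi.single 0 (T : ℤ)) 1 2 a * fpChartWeight β H r a) /
              (∫ a in smallField H s, fpChartWeight β H r a)))| ≤
      200 * (δ + ((boxState (fundamentalRep (Fin 2)) β H) {U | ¬ SmallPlaquettes H spl U}).toReal + τ) := by
  -- unfold the chart costs (`chartPlaqCost H x μ ν a = plaqCostAt ρ x μ ν (edgeChart H a)`) and the box covariance
  simp only [chartPlaqCost]
  have hbox : boxPlaqCov (fundamentalRep (Fin 2)) β H T =
      16 * ((∫ U, plaqCostAt (fundamentalRep (Fin 2)) (boxCentre H) 1 2 U *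
              plaqCostAt (fundamentalRep (Fin 2)) (boxCentre H + Pi.single 0 (T : ℤ)) 1 2 U / 16 ∂(boxState (fundamentalRep (Fin 2)) β H)) -
          (∫ U, plaqCostAt (fundamentalRep (Fin 2)) (boxCentre H) 1 2 U / 4 ∂(boxState (fundamentalRep (Fin 2)) β H)) *
            (∫ U, plaqCostAt (fundamentalRep (Fin 2)) (boxCentre H + Pi.single 0 (T : ℤ)) 1 2 U / 4 ∂(boxState (fundamentalRep (Fin 2)) β H))) := by
    simp only [boxPlaqCov, integral_div]
    ring
  rw [hbox]
  -- make the two base points opaque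
  generalize boxCentre H + Pi.single 0 (T : ℤ) = x₁
  generalize boxCentre H = x₀
  -- the two observables
  have hc0 : ∀ (x : Site 4) (U : LGConfig 4 SU2), 0 ≤ plaqCostAt (fundamentalRep (Fin 2)) x 1 2 U := fun x U => plaqCostAt_nonneg x 1 2 U
  have hc4 : ∀ (x : Site 4) (U : LGConfig 4 SU2), plaqCostAt (fundamentalRep (Fin 2)) x 1 2 U ≤ 4 :=
    fun x U => (le_abs_self _).trans (abs_plaqCostAt_le x 1 2 U)
  have hcm : ∀ x : Site 4, Measurable (plaqCostAt (fundamentalRep (Fin 2)) x 1 2) := fun x => measurable_plaqCostAt x 1 2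
  have hinv : ∀ (x : Site 4) (g : InteriorGauge H) (U : LGConfig 4 SU2),
      plaqCostAt (fundamentalRep (Fin 2)) x 1 2 (gaugeTransformZd (extendGauge H g) U) = plaqCostAt (fundamentalRep (Fin 2)) x 1 2 U :=
    fun x g U => plaqCostAt_gaugeTransformZd _ _ U x 1 2
  have h4 : (0 : ℝ) < 4 := by norm_num
  have h16 : (0 : ℝ) < 16 := by norm_num
  have hq1 : ∀ (x : Site 4) (U : LGConfig 4 SU2), plaqCostAt (fundamentalRep (Fin 2)) x 1 2 U / 4 ≤ 1 := fun x U => by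
    rw [div_le_one h4]; exact hc4 x U
  have hq0 : ∀ (x : Site 4) (U : LGConfig 4 SU2), 0 ≤ plaqCostAt (fundamentalRep (Fin 2)) x 1 2 U / 4 := fun x U => div_nonneg (hc0 x U) h4.le
  have hp1 : ∀ U : LGConfig 4 SU2, plaqCostAt (fundamentalRep (Fin 2)) x₀ 1 2 U * plaqCostAt (fundamentalRep (Fin 2)) x₁ 1 2 U / 16 ≤ 1 := fun U => by
    rw [div_le_one h16]
    calc plaqCostAt (fundamentalRep (Fin 2)) x₀ 1 2 U * plaqCostAt (fundamentalRep (Fin 2)) x₁ 1 2 U ≤ 4 * 4 :=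
        mul_le_mul (hc4 x₀ U) (hc4 x₁ U) (hc0 x₁ U) (by norm_num)
      _ = 16 := by norm_num
  have hp0 : ∀ U : LGConfig 4 SU2, 0 ≤ plaqCostAt (fundamentalRep (Fin 2)) x₀ 1 2 U * plaqCostAt (fundamentalRep (Fin 2)) x₁ 1 2 U / 16 :=
    fun U => div_nonneg (mul_nonneg (hc0 x₀ U) (hc0 x₁ U)) h16.le
  -- A+B+C for `c₀/4`, `c_T/4`, `c₀c_T/16`
  have h1 := abs_boxState_sub_smallField_ratio_le (H := H) hH hβ hδ0 hδ hrep hN hs0 hs1 hspl hτ0 hτ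
    (G := fun U => plaqCostAt (fundamentalRep (Fin 2)) x₀ 1 2 U / 4) (fun g U => by simp only [hinv]) ((hcm x₀).div_const 4) (hq0 x₀) (hq1 x₀)
  have h2 := abs_boxState_sub_smallField_ratio_le (H := H) hH hβ hδ0 hδ hrep hN hs0 hs1 hspl hτ0 hτ
    (G := fun U => plaqCostAt (fundamentalRep (Fin 2)) x₁ 1 2 U / 4) (fun g U => by simp only [hinv]) ((hcm x₁).div_const 4) (hq0 x₁) (hq1 x₁)
  have h3 := abs_boxState_sub_smallField_ratio_le (H := H) hH hβ hδ0 hδ hrep hN hs0 hs1 hspl hτ0 hτ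
    (G := fun U => plaqCostAt (fundamentalRep (Fin 2)) x₀ 1 2 U * plaqCostAt (fundamentalRep (Fin 2)) x₁ 1 2 U / 16)
    (fun g U => by simp only [hinv]) (((hcm x₀).mul (hcm x₁)).div_const 16) hp0 hp1
  -- sizes of `E₂` and `A₁`
  haveI := isProbabilityMeasure_boxState β H
  have hP0 : 0 ≤ ((boxState (fundamentalRep (Fin 2)) β H) {U | ¬ SmallPlaquettes H spl U}).toReal := ENNReal.toReal_nonneg
  have hE2 : 0 ≤ ∫ U, plaqCostAt (fundamentalRep (Fin 2)) x₁ 1 2 U / 4 ∂(boxState (fundamentalRep (Fin 2)) β H) :=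
    integral_nonneg (hq0 x₁)
  have hE2' : ∫ U, plaqCostAt (fundamentalRep (Fin 2)) x₁ 1 2 U / 4 ∂(boxState (fundamentalRep (Fin 2)) β H) ≤ 1 := by
    calc ∫ U, plaqCostAt (fundamentalRep (Fin 2)) x₁ 1 2 U / 4 ∂(boxState (fundamentalRep (Fin 2)) β H)
        ≤ ∫ _U, (1 : ℝ) ∂(boxState (fundamentalRep (Fin 2)) β H) :=
          integral_mono_of_nonneg (ae_of_all _ (hq0 x₁)) (integrable_const 1) (ae_of_all _ (hq1 x₁))
      _ = 1 := by simp
  have hw0 : ∀ a, 0 ≤ fpChartWeight β H r a := FPChart.fpChartWeight_nonneg β r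
  have hDm : MeasurableSet (smallField H s) := ChartGauss.measurableSet_smallField s
  have hDvol : volume (smallField H s) < ⊤ := SmallFieldFP.volume_smallField_lt_top hs0
  have hA1 : 0 ≤ (∫ a in smallField H s, plaqCostAt (fundamentalRep (Fin 2)) x₀ 1 2 (edgeChart H a) / 4 * fpChartWeight β H r a) /
      (∫ a in smallField H s, fpChartWeight β H r a) :=
    div_nonneg (setIntegral_nonneg hDm fun a _ => mul_nonneg (hq0 x₀ _) (hw0 a)) (setIntegral_nonneg hDm fun a _ => hw0 a)
  have hA1' : (∫ a in smallField H s, plaqCostAt (fundamentalRep (Fin 2)) x₀ 1 2 (edgeChart H a) / 4 * fpChartWeight β H r a) /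
      (∫ a in smallField H s, fpChartWeight β H r a) ≤ 1 := by
    refine div_le_one_of_le₀ ?_ (setIntegral_nonneg hDm fun a _ => hw0 a)
    have hGB : ∀ U, |plaqCostAt (fundamentalRep (Fin 2)) x₀ 1 2 U / 4| ≤ 1 := fun U => by
      rw [abs_of_nonneg (hq0 x₀ U)]; exact hq1 x₀ U
    have h1B : ∀ U : LGConfig 4 SU2, |(fun _ => (1 : ℝ)) U| ≤ 1 := fun U => by simp
    have hI := integrableOn_obs_mul_fpChartWeight (H := H) hβ.le r ((hcm x₀).div_const 4) hGB hDvol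
    have hIw : IntegrableOn (fun a => fpChartWeight β H r a) (smallField H s) := by
      have h := integrableOn_obs_mul_fpChartWeight (H := H) hβ.le r (measurable_const : Measurable fun _ : LGConfig 4 SU2 => (1 : ℝ)) h1B hDvol
      simp only [one_mul] at h
      exact h
    refine setIntegral_mono_on hI hIw hDm fun a _ => ?_
    calc plaqCostAt (fundamentalRep (Fin 2)) x₀ 1 2 (edgeChart H a) / 4 * fpChartWeight β H r a ≤ 1 * fpChartWeight β H r a :=
        mul_le_mul_of_nonneg_right (hq1 x₀ _) (hw0 a)
      _ = fpChartWeight β H r a := one_mul _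
  have hcov := cov_arith h1 h2 h3 hE2 hE2' hA1 hA1'
  -- the chart covariance is `16·(A₃ − A₁A₂)`
  have i1 : ∫ a in smallField H s, plaqCostAt (fundamentalRep (Fin 2)) x₀ 1 2 (edgeChart H a) *
        plaqCostAt (fundamentalRep (Fin 2)) x₁ 1 2 (edgeChart H a) / 16 * fpChartWeight β H r a =
      (∫ a in smallField H s, plaqCostAt (fundamentalRep (Fin 2)) x₀ 1 2 (edgeChart H a) *
        plaqCostAt (fundamentalRep (Fin 2)) x₁ 1 2 (edgeChart H a) * fpChartWeight β H r a) / 16 := by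
    rw [← integral_div]
    exact integral_congr_ae (ae_of_all _ fun a => by ring)
  have i2 : ∫ a in smallField H s, plaqCostAt (fundamentalRep (Fin 2)) x₀ 1 2 (edgeChart H a) / 4 * fpChartWeight β H r a =
      (∫ a in smallField H s, plaqCostAt (fundamentalRep (Fin 2)) x₀ 1 2 (edgeChart H a) * fpChartWeight β H r a) / 4 := by
    rw [← integral_div]
    exact integral_congr_ae (ae_of_all _ fun a => by ring)
  have i3 : ∫ a in smallField H s, plaqCostAt (fundamentalRep (Fin 2)) x₁ 1 2 (edgeChart H a) / 4 * fpChartWeight β H r a =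
      (∫ a in smallField H s, plaqCostAt (fundamentalRep (Fin 2)) x₁ 1 2 (edgeChart H a) * fpChartWeight β H r a) / 4 := by
    rw [← integral_div]
    exact integral_congr_ae (ae_of_all _ fun a => by ring)
  rw [i1, i2, i3] at hcov
  refine le_trans (le_of_eq ?_) (hcov.trans (by nlinarith [hδ0, hP0, hτ0]))
  congr 1
  ring

end BoxToChart

end Summit.QuantumFields.YangMills.Theorems.AllWindowsColdBoxBoxHighLine

end
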